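import Literature.MathematicalPhysics.KineticTheory.InfiniteChainGibbsInvariance

/-!
# `stub_bmFlowInvariant` of line `temperature-blind-vitali-hurwitz`
(crux `EmbeddedDrudeMourre.GreenKuboContinuation`, item stmt-AtomisticToContinuum-12597;
`--supports` helper file closing the registered stub 1b of the skeleton
`Cruxes/GreenKuboContinuation/Lines/temperature_blind_vitali_hurwitz.lean`)

**The temperature-blind flow preserves every superstable Gibbs state.** For the pinned anharmonic
chain `P = pinnedChain ω₂ lam β γ` (`U(q) = ω₂q²/2 + lam q⁴/4`, `V(r) = r²/2 + βr⁴/4`, all four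
parameters `> 0`) there is ONE infinite-volume dynamics `D` with carrier Buttà–Marchioro's
superstable set `𝒳₀ = bmGood P` such that, at every temperature `T > 0`, every DLR Gibbs state
`μ` of `P` obeying the superstability estimate BM (2.3) is preserved by `D`
(`D.PreservesMeasure μ`: `μ`-a.e. point is good and every `D.flow t` is measurable and measure
preserving).

This is the `s₁ = s₂ = 2` instance (`pinnedChain_isEvenPolyOfDegree_U/_V`) of the general
Literature theorem `OscillatorChain.exists_bmDynamics`
(`Literature/MathematicalPhysics/KineticTheory/InfiniteChainGibbsInvariance.lean`, landed with
this stub): the Buttà–Marchioro flow (Thm 2.1, `ButtaMarchioro2016_thm21_chain_holds`) taken on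
`𝒳₀` as the coordinatewise limit of the severed flows and extended by the identity off `𝒳₀`
(measurable: `measurableSet_bmGood`, `measurable_limUnder_severedFlow`); invariance from the
severed-flow invariance of Gibbs states (LLL 1977 §4 (i),
`measurePreserving_severedFlow_of_isChainGibbsMeasure`) by dominated convergence on bounded
continuous test functions of the Polish space `(ℝ × ℝ)^ℤ` (`measurePreserving_of_tendsto_ae`),
and `μ(𝒳₀ᶜ) = 0` from BM (2.6) (`ButtaMarchioro2016_eq26_chain_holds`). The hypotheses `0 < γ`
(bath coupling, absent from the Hamiltonian dynamics) and `0 < T` are not used.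
-/

noncomputable section

namespace Summit.AtomisticToContinuum.FouriersLaw.Theorems.GreenKuboContinuation.TemperatureBlindVitaliHurwitz

open MeasureTheory
open Literature.MathematicalPhysics.KineticTheory.HeatConduction

/-- **Stub 1b of line `temperature-blind-vitali-hurwitz` (registered signature).** For
`P = pinnedChain ω₂ lam β γ` (all `> 0`) there is an infinite-volume dynamics `D` with
`D.carrier = bmGood P` preserving, at every `T > 0`, every DLR Gibbs state of `P` at `T` that
obeys the superstability estimate (2.3). Corollary of `OscillatorChain.exists_bmDynamics` with
`s₁ = s₂ = 2`. [cite: ButtaMarchioro2016, §2 Thm 2.1 and eq. (2.6)] -/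
theorem stub_bmFlowInvariant :
    ∀ ω₂ lam β γ : ℝ, 0 < ω₂ → 0 < lam → 0 < β → 0 < γ →
      ∃ D : Literature.MathematicalPhysics.KineticTheory.HeatConduction.InfiniteChainDynamics
          (Literature.MathematicalPhysics.KineticTheory.HeatConduction.pinnedChain ω₂ lam β γ),
        D.carrier =
            (Literature.MathematicalPhysics.KineticTheory.HeatConduction.pinnedChain
                ω₂ lam β γ).bmGood ∧
          ∀ T : ℝ, 0 < T →
            ∀ μ : MeasureTheory.Measure
                Literature.MathematicalPhysics.KineticTheory.HeatConduction.ChainConfig,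
              (Literature.MathematicalPhysics.KineticTheory.HeatConduction.pinnedChain
                ω₂ lam β γ).IsChainGibbsMeasure T μ →
              (Literature.MathematicalPhysics.KineticTheory.HeatConduction.pinnedChain
                ω₂ lam β γ).HasSuperstabilityEstimate μ →
              D.PreservesMeasure μ := by
  intro ω₂ lam β γ hω hl hβ _
  obtain ⟨D, hD, -, -, -, -, -, hpres⟩ :=
    OscillatorChain.exists_bmDynamics (P := pinnedChain ω₂ lam β γ) (s₁ := 2) (s₂ := 2)
      (by norm_num) (by norm_num) (OscillatorChain.pinnedChain_isEvenPolyOfDegree_U β γ hω.le hl)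
      (OscillatorChain.pinnedChain_isEvenPolyOfDegree_V ω₂ lam γ hβ)
  exact ⟨D, hD, fun T _ μ hμ hSS => hpres T μ hμ hSS⟩

/-- The same dynamics, with the extras of `OscillatorChain.exists_bmDynamics` that the line's
other stubs may consume: measurable flow maps, identity off `bmGood`, the group law on `bmGood`,
and preservation of every superstable Gibbs state at every temperature (no sign condition on `T`
is needed). [cite: ButtaMarchioro2016, §2 Thm 2.1 and eq. (2.6)] -/
theorem exists_bmDynamics_pinnedChain {ω₂ lam β : ℝ} (γ : ℝ) (hω : 0 ≤ ω₂) (hl : 0 < lam)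
    (hβ : 0 < β) :
    ∃ D : InfiniteChainDynamics (pinnedChain ω₂ lam β γ),
      D.carrier = (pinnedChain ω₂ lam β γ).bmGood ∧
      (∀ t : ℝ, Measurable (D.flow t)) ∧
      (∀ t : ℝ, ∀ σ ∉ (pinnedChain ω₂ lam β γ).bmGood, D.flow t σ = σ) ∧
      (∀ t s : ℝ, ∀ σ ∈ (pinnedChain ω₂ lam β γ).bmGood,
        D.flow (t + s) σ = D.flow t (D.flow s σ)) ∧
      ∀ (T : ℝ) (μ : Measure ChainConfig), (pinnedChain ω₂ lam β γ).IsChainGibbsMeasure T μ →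
        (pinnedChain ω₂ lam β γ).HasSuperstabilityEstimate μ → D.PreservesMeasure μ := by
  obtain ⟨D, hD, hm, hid, hgrp, -, -, hpres⟩ :=
    OscillatorChain.exists_bmDynamics (P := pinnedChain ω₂ lam β γ) (s₁ := 2) (s₂ := 2)
      (by norm_num) (by norm_num) (OscillatorChain.pinnedChain_isEvenPolyOfDegree_U β γ hω hl)
      (OscillatorChain.pinnedChain_isEvenPolyOfDegree_V ω₂ lam γ hβ)
  exact ⟨D, hD, hm, hid, hgrp, hpres⟩

/-- Canonicity for the pinned chain: ANY dynamics with carrier `bmGood` and measurable flow maps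
preserves every superstable Gibbs state (instance of
`OscillatorChain.preservesMeasure_of_carrier_eq_bmGood`).
[cite: ButtaMarchioro2016, §2 Thm 2.1 and eq. (2.6)] -/
theorem preservesMeasure_of_carrier_eq_bmGood_pinnedChain {ω₂ lam β : ℝ} (γ : ℝ) (hω : 0 ≤ ω₂)
    (hl : 0 < lam) (hβ : 0 < β) (D : InfiniteChainDynamics (pinnedChain ω₂ lam β γ))
    (hD : D.carrier = (pinnedChain ω₂ lam β γ).bmGood) (hDm : ∀ t, Measurable (D.flow t))
    {T : ℝ} {μ : Measure ChainConfig} (hμ : (pinnedChain ω₂ lam β γ).IsChainGibbsMeasure T μ)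
    (hSS : (pinnedChain ω₂ lam β γ).HasSuperstabilityEstimate μ) : D.PreservesMeasure μ :=
  OscillatorChain.preservesMeasure_of_carrier_eq_bmGood (s₁ := 2) (s₂ := 2) (by norm_num)
    (by norm_num) (OscillatorChain.pinnedChain_isEvenPolyOfDegree_U β γ hω hl)
    (OscillatorChain.pinnedChain_isEvenPolyOfDegree_V ω₂ lam γ hβ) D hD hDm hμ hSS

end Summit.AtomisticToContinuum.FouriersLaw.Theorems.GreenKuboContinuation.TemperatureBlindVitaliHurwitz

end
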